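import Summits.Ventures.HSemireg.UntwistCocycleTwistTrace
import HarnessLib

/-!
# Venture HSemireg — route R1.0, untwisted reading: the comparison
# `λ_G : (𝓗om(E^∨, G)) ⊗ M ⟶ 𝓗om((E ⊗ M)^∨, G)` on real carriers (gs-g4; first input of the rows
# `q ≥ 1` of the Leibniz re-expansion `hσ`)

HONEST FRAMING. Module-level sheaf algebra on the tree's REAL carriers (the internal Hom `Modules.sheafHom`,
the cocycle twist `CocycleTwist.twist c F = F ⊗ M`, `M = lineBundle c`, of th-4's files #11–#17, the contraction
`Modules.contract` and the trace with coefficients `HodgeTheory.traceExtCoeff`). Nothing about any variety; no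
gerbe; nothing here says HC, HC_CM or HC_AV is proved.

WHAT THIS FILE IS FOR. The higher semiregularity components `σ_q(x) = Tr_{Ω^q}(x · ι · At(E)^q)` of
`E ⊗ M = E⟨c⟩` live on the carriers `𝓗om((E⟨c⟩)^∨, Ω^q)`, whereas the twist functor `θ = - ⊗ M` carries the
`E`-side classes to `(𝓗om(E^∨, Ω^q))⟨c⟩`. The rows `q ≥ 1` of the Leibniz re-expansion `hσ`
(`UntwistCocycleTwistSigma.lean` §2, the one binder left) need a comparison between the two. Here:

* `precompOver t B : 𝓗om(A', B)|_W ⟶ 𝓗om(A, B)|_W` — pre-composition with a LOCAL morphism `t : A|_W ⟶ A'|_W`;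
* `dualHomTwist c E G : (𝓗om(E^∨, G))⟨c⟩ ⟶ 𝓗om((E⟨c⟩)^∨, G)` (`λ_G`) — GLUED (tree: `Modules.glueHom`) from
  the pieces over the cover of `c`: a glue family `(φ_x)_x`, `φ_x = g_{xy} φ_y`, is sent to
  `μ ↦ φ_x(t_x^* μ)` over `U_x`, `t_x : E| ≅ E⟨c⟩|` the local trivialisation of th-4's file #14 (the pieces
  agree on overlaps because `t_x = g_{yx} · t_y`); `appLE_dualHomTwist` (values over an open inside one `U_x`);
* `dualHomTwist_trivSection_evalAt_smulSection` — **`λ_G((e ⊗ t) ⊗ t_z) = (e ⊗ t_z) ⊗ t`**: on the sections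
  `μ ↦ μ(e) · t` (`evalAt e ≫ smulSection t`, the shape of Atiyah's twisting term `δ(a, e) = e ⊗ da`) the
  comparison is the identity in the local trivialisations — the input making the transported jet splittings
  `𝒪`-linear in the sequel;
* the compatibility of `λ_G` with the contractions / the traces with coefficients is the sequel
  `UntwistCocycleTwistDualHomTrace.lean`.

Which Ext groups: `Extⁿ(E, E ⊗ G)` modelled as `Extⁿ(E, 𝓗om(E^∨, G))` and its image `Extⁿ(E⟨c⟩, 𝓗om((E⟨c⟩)^∨, G))`;
which class: none yet (the Atiyah class enters in the sequel); which twist: `- ⊗ M_B`, `M_B = lineBundle c`.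

## References

* R. Hartshorne, *Algebraic Geometry*, GTM 52 (1977), II.5, II Ex. 5.1 (b) (`𝓗om(E^∨, G) ≅ E ⊗ G`),
  II Ex. 1.22 (glueing). [Hartshorne1977]
* R.-O. Buchweitz, H. Flenner, *A semiregularity map for modules and applications to deformations*, Compositio
  Math. 137 (2003), §4 (trace maps `Tr : Ext^k(F, F ⊗ G) → H^k(X, G)`). [BuchweitzFlenner2003]
* The Stacks Project, Tag 01CM (internal Hom), Tag 01CR (invertible modules). [StacksProject]
-/

noncomputable section

open CategoryTheory CategoryTheory.Abelian AlgebraicGeometry Opposite TopologicalSpace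

namespace Summit.Ventures.HSemireg

namespace CocycleTwist

open Literature.AlgebraicGeometry.Modules Literature.AlgebraicGeometry.Motives
  Literature.AlgebraicGeometry.HodgeTheory

universe u

variable {X : Scheme.{u}} (c : UnitCocycle X) {A A' B E G M N : X.Modules} {U W : X.Opens}

/-! ### Pre-composition with a local morphism on internal Homs -/

variable (B) in
/-- **`𝓗om(A', B)|_W ⟶ 𝓗om(A, B)|_W`, `ψ ↦ t| ≫ ψ`**, for a LOCAL morphism `t : A|_W ⟶ A'|_W` (the tree's
`sheafHomMapLeft` is the case of a global `t`). [folklore] -/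
def precompOver (t : A.over W ⟶ A'.over W) : (sheafHom A' B).over W ⟶ (sheafHom A B).over W where
  val := PresheafOfModules.homMk
    { app := fun V => AddCommGrpCat.ofHom
        { toFun := fun (ψ : A'.over V.unop.left ⟶ B.over V.unop.left) =>
            (restrictHom V.unop.hom t ≫ ψ : A.over V.unop.left ⟶ B.over V.unop.left)
          map_zero' := Limits.comp_zero
          map_add' := fun ψ ψ' => Preadditive.comp_add _ _ _ _ _ _ }
      naturality := fun {V V'} i => by
        refine AddCommGrpCat.ext fun (ψ : A'.over V.unop.left ⟶ B.over V.unop.left) => ?_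
        change restrictHom V'.unop.hom t ≫ restrictHom i.unop.left ψ =
          restrictHom i.unop.left (restrictHom V.unop.hom t ≫ ψ)
        rw [restrictHom_comp, ← restrictHom_comp',
          Subsingleton.elim (i.unop.left ≫ V.unop.hom) V'.unop.hom] }
    (fun V (a : Γ(X, V.unop.left)) (ψ : A'.over V.unop.left ⟶ B.over V.unop.left) => by
      change restrictHom V.unop.hom t ≫ (a • ψ) = a • (restrictHom V.unop.hom t ≫ ψ)
      rw [smul_overHom_def, smul_overHom_def, Category.assoc])

/-- Values of `precompOver t`: `ψ ↦ t|_V ≫ ψ`. [folklore] -/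
@[simp]
theorem appLE_precompOver (t : A.over W ⟶ A'.over W) {V : X.Opens} (k : V ⟶ W)
    (ψ : A'.over V ⟶ B.over V) :
    appLE (precompOver B t) k (ψ : Γ(sheafHom A' B, V)) = (restrictHom k t ≫ ψ : Γ(sheafHom A B, V)) :=
  rfl

/-- Restricting `precompOver t` is `precompOver` of the restricted `t`. [folklore] -/
theorem restrictHom_precompOver (t : A.over W ⟶ A'.over W) {V : X.Opens} (i : V ⟶ W) :
    restrictHom i (precompOver B t) = precompOver B (restrictHom i t) :=
  hom_ext_of_appLE fun V' k (ψ : A'.over V' ⟶ B.over V') => by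
    rw [appLE_restrictHom, appLE_precompOver, appLE_precompOver, restrictHom_comp']

/-! ### Locality of morphisms of restricted modules along the cover of the cocycle -/

/-- Two morphisms `M|_U ⟶ N|_U` agree as soon as their values agree on sections over the opens `W ≤ U`
lying inside a member `U_x` of the cover of `c` (sheaf property of `N`). [folklore] -/
theorem hom_ext_of_appLE_le {φ ψ : M.over U ⟶ N.over U}
    (h : ∀ (x : X) ⦃W : X.Opens⦄ (k : W ⟶ U) (_ : W ≤ c.U x) (s : Γ(M, W)), appLE φ k s = appLE ψ k s) :
    φ = ψ := by
  refine hom_ext_of_appLE fun W k s => ?_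
  refine TopCat.Sheaf.eq_of_locally_eq' ((SheafOfModules.toSheaf _).obj N) (fun x : X => W ⊓ c.U x) W
    (fun x => homOfLE inf_le_left)
    (fun y hy => Opens.mem_iSup.2 ⟨y, hy, c.mem y⟩) _ _ fun x => ?_
  change N.presheaf.map (homOfLE _).op (appLE φ k s) = N.presheaf.map (homOfLE _).op (appLE ψ k s)
  rw [← appLE_map, ← appLE_map]
  exact h x _ inf_le_right _

/-! ### The local trivialisations at two points differ by the transition function -/

variable (E) in
/-- `e ⊗ t_x = (g_{yx} e) ⊗ t_y` over `V ⊆ U_x ∩ U_y` (`g_{wx} = g_{wy} g_{yx}`). [folklore] -/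
theorem trivSection_eq_trivSection_smul (x y : X) {V : X.Opens} (hx : V ≤ c.U x) (hy : V ≤ c.U y)
    (e : Γ(E, V)) :
    trivSection c E x hx e = trivSection c E y hy (c.g y x V hy hx • e) :=
  twist_ext c E fun w => by
    rw [comp_trivSection, comp_trivSection, Scheme.Modules.map_smul, smul_smul, map_g_apply, c.g_mul]

variable (E) in
/-- `toTwistOver` at `x` is `toTwistOver` at `y` after multiplication by `g_{yx}`, over `V ⊆ U_x ∩ U_y`.
[folklore] -/
theorem toTwistOver_eq_overScalar_comp (x y : X) (V : X.Opens) (hx : V ≤ c.U x) (hy : V ≤ c.U y) :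
    toTwistOver c E x V hx = overScalar E V (c.g y x V hy hx) ≫ toTwistOver c E y V hy :=
  hom_ext_of_appLE fun W k e => by
    rw [appLE_toTwistOver, appLE_comp, appLE_overScalar, appLE_toTwistOver,
      trivSection_eq_trivSection_smul c E x y (k.le.trans hx) (k.le.trans hy)]
    congr 1
    exact congrArg (· • e) (map_g_apply c y x hy hx k.le).symm

variable (E) in
/-- Restricting `toTwistOver` gives `toTwistOver` over the smaller open. [folklore] -/
theorem restrictHom_toTwistOver (x : X) (V : X.Opens) (hx : V ≤ c.U x) {V' : X.Opens} (i : V' ⟶ V) :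
    restrictHom i (toTwistOver c E x V hx) = toTwistOver c E x V' (i.le.trans hx) :=
  hom_ext_of_appLE fun W k e => by rw [appLE_restrictHom, appLE_toTwistOver, appLE_toTwistOver]

/-- A morphism of restricted modules commutes with multiplication by a scalar (the tree's
`HodgeTheory.overScalar_comp_eq`, for a plain scheme). [folklore] -/
theorem overScalar_comp_eq' (g : M.over U ⟶ N.over U) (a : Γ(X, U)) :
    overScalar M U a ≫ g = g ≫ overScalar N U a :=
  hom_ext_of_appLE fun W k s => by
    rw [appLE_comp, appLE_comp, appLE_overScalar, appLE_smul_right, appLE_overScalar]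

/-- `(a • φ)(s) = a| • φ(s)` for the `𝒪_X(U)`-module structure on local homomorphisms, in the form of a
term (avoids instance-matching in rewrites). [folklore] -/
theorem appLE_smul' (a : Γ(X, U)) (φ : M.over U ⟶ N.over U) {W' : X.Opens} (k : W' ⟶ U) (s : Γ(M, W')) :
    appLE (φ ≫ overScalar N U a) k s = X.presheaf.map k.op a • appLE φ k s := by
  rw [appLE_comp, appLE_overScalar]

/-! ### The pieces of `λ_G` over the members of the cover -/

section Pieces

variable (E G) {V : X.Opens} (s : Γ(twist c (sheafHom (dual E) G), V))

/-- **The piece of `λ_G(s)` over `V ∩ U_x`**: `μ ↦ s_x(t_x| ≫ μ)` for `μ` a local section of `(E⟨c⟩)^∨`,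
`t_x : E| → E⟨c⟩|` the local trivialisation, `s_x` the `x`-component of the glue family `s`. [folklore] -/
def dualHomTwistPiece (x : X) : (dual (twist c E)).over (V ⊓ c.U x) ⟶ G.over (V ⊓ c.U x) :=
  precompOver (unitModule X) (toTwistOver c E x (V ⊓ c.U x) inf_le_right) ≫
    (comp c (sheafHom (dual E) G) s x : (dual E).over (V ⊓ c.U x) ⟶ G.over (V ⊓ c.U x))

/-- Values of the piece: `μ ↦ s_x(t_x|_W ≫ μ)`. [folklore] -/
theorem appLE_dualHomTwistPiece (x : X) {W : X.Opens} (k : W ⟶ V ⊓ c.U x)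
    (μ : (twist c E).over W ⟶ (unitModule X).over W) :
    appLE (dualHomTwistPiece c E G s x) k (μ : Γ(dual (twist c E), W)) =
      appLE (comp c (sheafHom (dual E) G) s x : (dual E).over (V ⊓ c.U x) ⟶ G.over (V ⊓ c.U x)) k
        ((toTwistOver c E x W (k.le.trans inf_le_right) ≫ μ : Γ(dual E, W))) := by
  rw [dualHomTwistPiece, appLE_comp, appLE_precompOver, restrictHom_toTwistOver]

/-- The value of the `x`-piece on `μ` over `W ⊆ V ∩ U_x ∩ U_y` equals the value of the `y`-piece
(`s_x = g_{xy} s_y`, `t_x = g_{yx} t_y`, `g_{xy} g_{yx} = 1`). [folklore] -/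
theorem appLE_dualHomTwistPiece_eq (x y : X) {W : X.Opens} (kx : W ⟶ V ⊓ c.U x) (ky : W ⟶ V ⊓ c.U y)
    (μ : (twist c E).over W ⟶ (unitModule X).over W) :
    appLE (dualHomTwistPiece c E G s x) kx (μ : Γ(dual (twist c E), W)) =
      appLE (dualHomTwistPiece c E G s y) ky (μ : Γ(dual (twist c E), W)) := by
  have hW : W ≤ V := kx.le.trans inf_le_left
  have hx : W ≤ c.U x := kx.le.trans inf_le_right
  have hy : W ≤ c.U y := ky.le.trans inf_le_right
  rw [appLE_dualHomTwistPiece, appLE_dualHomTwistPiece]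
  -- move both values to the open `W` itself (restrict the components `s_x`, `s_y` to `W`)
  rw [appLE_congr_hom _ kx (𝟙 W ≫ homOfLE (le_inf hW hx)), appLE_congr_hom _ ky (𝟙 W ≫ homOfLE (le_inf hW hy)),
    ← appLE_restrictHom, ← appLE_restrictHom]
  have hrel := comp_rel c (sheafHom (dual E) G) s x y hW hx hy
  change restrictHom (homOfLE (le_inf hW hx)) (comp c (sheafHom (dual E) G) s x) =
    c.g x y W hx hy • restrictHom (homOfLE (le_inf hW hy)) (comp c (sheafHom (dual E) G) s y) at hrel
  rw [hrel, smul_overHom_def, appLE_smul', toTwistOver_eq_overScalar_comp c E x y W hx hy, Category.assoc,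
    overScalar_comp_eq', ← smul_overHom_def]
  erw [appLE_smul_right]
  rw [smul_smul, op_id, X.presheaf.map_id]
  change (c.g x y W hx hy * c.g y x W hy hx) • _ = _
  rw [c.g_mul_symm, one_smul]

/-- The pieces are compatible on overlaps. [folklore] -/
theorem dualHomTwistPiece_compatible (x y : X) :
    restrictHom (Opens.infLELeft (V ⊓ c.U x) (V ⊓ c.U y)) (dualHomTwistPiece c E G s x) =
      restrictHom (Opens.infLERight (V ⊓ c.U x) (V ⊓ c.U y)) (dualHomTwistPiece c E G s y) :=
  hom_ext_of_appLE fun W k (μ : (twist c E).over W ⟶ (unitModule X).over W) => by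
    rw [appLE_restrictHom, appLE_restrictHom]
    exact appLE_dualHomTwistPiece_eq c E G s x y _ _ μ

/-- `V` is covered by the `V ∩ U_x`. [folklore] -/
theorem le_iSup_inf_U (V : X.Opens) : V ≤ ⨆ x : X, V ⊓ c.U x := fun v hv =>
  Opens.mem_iSup.2 ⟨v, hv, c.mem v⟩

/-- **`λ_G(s) : (E⟨c⟩)^∨|_V ⟶ G|_V`**, glued from the pieces. [folklore] -/
def dualHomTwistApp : (dual (twist c E)).over V ⟶ G.over V :=
  restrictHom (homOfLE (le_iSup_inf_U c V))
    (glueHom (fun x : X => V ⊓ c.U x) (dualHomTwistPiece c E G s) (dualHomTwistPiece_compatible c E G s))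

/-- **Values of `λ_G(s)` over an open inside `U_x`**: the value of the `x`-piece. [folklore] -/
theorem appLE_dualHomTwistApp (x : X) {W : X.Opens} (k : W ⟶ V) (hx : W ≤ c.U x)
    (μ : (twist c E).over W ⟶ (unitModule X).over W) :
    appLE (dualHomTwistApp c E G s) k (μ : Γ(dual (twist c E), W)) =
      appLE (comp c (sheafHom (dual E) G) s x : (dual E).over (V ⊓ c.U x) ⟶ G.over (V ⊓ c.U x))
        (homOfLE (le_inf k.le hx)) ((toTwistOver c E x W hx ≫ μ : Γ(dual E, W))) := by
  rw [dualHomTwistApp, appLE_restrictHom, appLE_glueHom,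
    glueValue_eq_appLE (fun x : X => V ⊓ c.U x) _ (dualHomTwistPiece_compatible c E G s) x
      (homOfLE (le_inf k.le hx)), appLE_dualHomTwistPiece]

end Pieces

/-! ### `λ_G` as a morphism of `𝒪_X`-modules -/

section Lambda

variable (E G)

/-- `λ_G` is additive on sections. [folklore] -/
theorem dualHomTwistApp_add {V : X.Opens} (s s' : Γ(twist c (sheafHom (dual E) G), V)) :
    dualHomTwistApp c E G (s + s') = dualHomTwistApp c E G s + dualHomTwistApp c E G s' :=
  hom_ext_of_appLE_le c fun x W k hx (μ : (twist c E).over W ⟶ (unitModule X).over W) => by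
    rw [appLE_add, appLE_dualHomTwistApp c E G _ x k hx, appLE_dualHomTwistApp c E G _ x k hx,
      appLE_dualHomTwistApp c E G _ x k hx, comp_add]
    exact appLE_add _ _ _ _

/-- `λ_G(0) = 0`. [folklore] -/
theorem dualHomTwistApp_zero {V : X.Opens} :
    dualHomTwistApp c E G (0 : Γ(twist c (sheafHom (dual E) G), V)) = 0 :=
  hom_ext_of_appLE_le c fun x W k hx (μ : (twist c E).over W ⟶ (unitModule X).over W) => by
    rw [appLE_dualHomTwistApp c E G _ x k hx, comp_zero]
    exact appLE_zero _ _

/-- `λ_G` is `𝒪_X(V)`-linear on sections. [folklore] -/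
theorem dualHomTwistApp_smul {V : X.Opens} (a : Γ(X, V)) (s : Γ(twist c (sheafHom (dual E) G), V)) :
    dualHomTwistApp c E G (a • s) = a • dualHomTwistApp c E G s :=
  hom_ext_of_appLE_le c fun x W k hx (μ : (twist c E).over W ⟶ (unitModule X).over W) => by
    rw [smul_overHom_def, appLE_smul', appLE_dualHomTwistApp c E G _ x k hx, appLE_dualHomTwistApp c E G _ x k hx,
      comp_smul]
    change appLE ((comp c (sheafHom (dual E) G) s x : (dual E).over (V ⊓ c.U x) ⟶ G.over (V ⊓ c.U x)) ≫
      overScalar G (V ⊓ c.U x) (X.presheaf.map (homOfLE (inf_le_left : V ⊓ c.U x ≤ V)).op a)) _ _ = _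
    rw [appLE_smul', ← CategoryTheory.comp_apply, ← Functor.map_comp]
    rfl

/-- `λ_G` commutes with restriction on sections. [folklore] -/
theorem dualHomTwistApp_map {V V' : X.Opens} (i : V' ⟶ V) (s : Γ(twist c (sheafHom (dual E) G), V)) :
    dualHomTwistApp c E G ((twist c (sheafHom (dual E) G)).presheaf.map i.op s) =
      restrictHom i (dualHomTwistApp c E G s) :=
  hom_ext_of_appLE_le c fun x W k hx (μ : (twist c E).over W ⟶ (unitModule X).over W) => by
    rw [appLE_restrictHom, appLE_dualHomTwistApp c E G _ x k hx,
      appLE_dualHomTwistApp c E G _ x (k ≫ i) hx, comp_map_hom]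
    change appLE (restrictHom (homOfLE _) (comp c (sheafHom (dual E) G) s x :
      (dual E).over (V ⊓ c.U x) ⟶ G.over (V ⊓ c.U x))) _ _ = _
    rw [appLE_restrictHom]
    exact appLE_congr_hom _ _ _ _

/-- **`λ_G : (𝓗om(E^∨, G))⟨c⟩ ⟶ 𝓗om((E⟨c⟩)^∨, G)`** — the comparison `(E ⊗ G) ⊗ M ⟶ (E ⊗ M) ⊗ G` on the
internal-Hom models of the tree: a glue family `(φ_x)_x` (`φ_x = g_{xy} φ_y`, local homomorphisms
`E^∨ → G`) goes to the homomorphism `(E⟨c⟩)^∨ → G` which over `U_x` is `μ ↦ φ_x(t_x^* μ)`.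
[cite: Hartshorne1977, II Ex. 5.1 (b); StacksProject, Tag 01CM] -/
def dualHomTwist : twist c (sheafHom (dual E) G) ⟶ sheafHom (dual (twist c E)) G where
  val := PresheafOfModules.homMk
    { app := fun V => AddCommGrpCat.ofHom
        { toFun := fun s => (dualHomTwistApp c E G (V := V.unop) s :
            (dual (twist c E)).over V.unop ⟶ G.over V.unop)
          map_zero' := dualHomTwistApp_zero c E G
          map_add' := fun s s' => dualHomTwistApp_add c E G s s' }
      naturality := fun {V V'} i => by
        ext s
        change dualHomTwistApp c E G ((twist c (sheafHom (dual E) G)).presheaf.map i s) =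
          restrictHom i.unop (dualHomTwistApp c E G s)
        have ei : i = (homOfLE i.unop.le).op := Subsingleton.elim _ _
        rw [ei]
        exact dualHomTwistApp_map c E G (homOfLE i.unop.le) s }
    (fun V (a : Γ(X, V.unop)) (s : Γ(twist c (sheafHom (dual E) G), V.unop)) => by
      change dualHomTwistApp c E G (a • s) = a • dualHomTwistApp c E G s
      exact dualHomTwistApp_smul c E G a s)

/-- Sections of `λ_G`. [folklore] -/
@[simp]
theorem dualHomTwist_app_apply {V : X.Opens} (s : Γ(twist c (sheafHom (dual E) G), V)) :
    (dualHomTwist c E G).app V s = dualHomTwistApp c E G s := rfl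

/-- **Values of `λ_G` over an open inside `U_x`.** [folklore] -/
theorem appLE_dualHomTwist (x : X) {V W : X.Opens} (s : Γ(twist c (sheafHom (dual E) G), V)) (k : W ⟶ V)
    (hx : W ≤ c.U x) (μ : (twist c E).over W ⟶ (unitModule X).over W) :
    appLE ((dualHomTwist c E G).app V s : (dual (twist c E)).over V ⟶ G.over V) k
        (μ : Γ(dual (twist c E), W)) =
      appLE (comp c (sheafHom (dual E) G) s x : (dual E).over (V ⊓ c.U x) ⟶ G.over (V ⊓ c.U x))
        (homOfLE (le_inf k.le hx)) ((toTwistOver c E x W hx ≫ μ : Γ(dual E, W))) :=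
  appLE_dualHomTwistApp c E G s x k hx μ

end Lambda

/-! ### `λ_G((e ⊗ t) ⊗ t_z) = (e ⊗ t_z) ⊗ t` -/

section Delta

variable (E G)

/-- **`λ_G` on the twisted sections of `μ ↦ μ(e) · t`**: for `W ⊆ U_z`, `e ∈ Γ(E, W)`, `t ∈ Γ(G, W)`,
`λ_G((evalAt e ≫ smulSection t) ⊗ t_z) = evalAt (e ⊗ t_z) ≫ smulSection t` — the `E`-side section
`ν ↦ ν(e) t` of `𝓗om(E^∨, G)`, twisted by `t_z`, goes to the `E⟨c⟩`-side section `μ ↦ μ(e ⊗ t_z) t` of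
`𝓗om((E⟨c⟩)^∨, G)` (over `U_x`: `g_{xz} · μ(e ⊗ t_x) = μ(e ⊗ t_z)` as `e ⊗ t_z = (g_{xz} e) ⊗ t_x`). This is
the case `t = da` of Atiyah's twisting term `δ(a, e) = e ⊗ da`. [folklore] -/
theorem dualHomTwist_trivSection_evalAt_smulSection (z : X) {W : X.Opens} (hW : W ≤ c.U z) (e : Γ(E, W))
    (t : Γ(G, W)) :
    ((dualHomTwist c E G).app W
        (trivSection c (sheafHom (dual E) G) z hW
          ((evalAt (M := unitModule X) e ≫ smulSection t : (dual E).over W ⟶ G.over W))) :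
        (dual (twist c E)).over W ⟶ G.over W) =
      evalAt (M := unitModule X) (trivSection c E z hW e) ≫ smulSection t := by
  refine hom_ext_of_appLE_le c fun x W' k hx (μ : (twist c E).over W' ⟶ (unitModule X).over W') => ?_
  have hz : W' ≤ c.U z := k.le.trans hW
  -- the right-hand side: `μ(e ⊗ t_z) · t = g_{xz} μ(e ⊗ t_x) · t`
  have hR : appLE (evalAt (M := unitModule X) (trivSection c E z hW e) ≫ smulSection t) k (μ : Γ(dual (twist c E), W')) =
      c.g x z W' hx hz • appLE (smulSection t) k (appLE μ (𝟙 W') (trivSection c E x hx (E.presheaf.map k.op e))) := by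
    rw [appLE_comp, appLE_evalAt, trivSection_map, trivSection_eq_trivSection_smul c E z x hz hx, trivSection_smul]
    simp only [appLE_smul_right]
  -- the left-hand side: the `x`-component `g_{xz} · (evalAt e ≫ smulSection t)|` evaluated on `t_x ≫ μ`
  have hL : appLE ((dualHomTwist c E G).app W (trivSection c (sheafHom (dual E) G) z hW
        ((evalAt (M := unitModule X) e ≫ smulSection t : (dual E).over W ⟶ G.over W))) :
        (dual (twist c E)).over W ⟶ G.over W) k (μ : Γ(dual (twist c E), W')) =
      c.g x z W' hx hz • appLE (smulSection t) k (appLE μ (𝟙 W') (trivSection c E x hx (E.presheaf.map k.op e))) := by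
    rw [appLE_dualHomTwist c E G x _ k hx, comp_trivSection]
    change appLE ((restrictHom (homOfLE (inf_le_left : W ⊓ c.U x ≤ W))
        (evalAt (M := unitModule X) e ≫ smulSection t : (dual E).over W ⟶ G.over W)) ≫
        overScalar G (W ⊓ c.U x) (c.g x z (W ⊓ c.U x) inf_le_right (inf_le_left.trans hW))) _ _ = _
    rw [appLE_smul', appLE_restrictHom, map_g_apply, appLE_congr_hom _ (homOfLE (le_inf k.le hx) ≫ homOfLE _) k,
      appLE_comp, appLE_evalAt, appLE_comp, appLE_toTwistOver]
  rw [hL, hR]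

end Delta

end CocycleTwist

end Summit.Ventures.HSemireg

end
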